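import Literature.Analysis.FluidPDE.AxisymNoSwirlCoSignedFlux
import HarnessLib

/-!
# Axisymmetric flows without swirl: the maximum principle for `ω_θ/r` on the whole space
# (Ukhovskii–Yudovich / Ladyzhenskaya 1968; KNSS 2009, §5), in Tao's smooth class

Analysis/FluidPDE proof file (theorems only; no definitions, no named facts).

For the axisymmetric Navier–Stokes equations **without swirl** the quotient `η = Ω = ω_θ/r`
satisfies the drift–diffusion equation without zeroth-order term

> `(ω_θ/r)_t + u_r (ω_θ/r)_r + u_z (ω_θ/r)_z = Δ(ω_θ/r) + (2/r)(ω_θ/r)_r`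

(G. Koch, N. Nadirashvili, G. Seregin, V. Šverák, Acta Math. 203 (2009) = arXiv:0709.3599, §5,
the equation before Remark 5.1, arXiv p. 9; "the diffusion term … can be interpreted as the
5-dimensional Laplacian acting on SO(4)-invariant functions in ℝ⁵"; p. 3: "In each case there is
a scalar quantity satisfying a maximum principle … The quantities we use and the corresponding
maximum principles are all classical"), whence the classical **maximum principle**
`‖(ω_θ/r)(t)‖_{L^∞} ≤ ‖(ω_θ/r)(s)‖_{L^∞}` (`s ≤ t`) and the preservation of the sign of `ω_θ`
(Th. Gallay, V. Šverák, Confluentes Math. 7 (2015) = arXiv:1510.01036, §5, proof of Lemma 5.1,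
arXiv p. 16: "By the strong maximum principle, the solution `ω_θ(t)` … is strictly positive";
M. R. Ukhovskii, V. I. Yudovich 1968; O. A. Ladyzhenskaya 1968).

The tree holds this maximum principle in LOCAL form (a bound on the parabolic boundary of a
cylinder propagates inside: `noSwirl_abs_scalar_le_of_boundary`, `AxisymNoSwirlLocalMaxPrinciple`,
comparison argument on the lifted ball of `ℝ⁵`) and, for the swirl `Γ = r u_θ`, in whole-space
form (`IsTaoSolutionOn.abs_swirl_le`, `SwirlMaximumPrinciple`). This file proves the WHOLE-SPACE
statements for `Ω = angVortQuot = ω_θ/r` along a Tao-class solution (`IsTaoSolutionOn T ν u₀ v q`,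
`ν ≥ 0`, slices axisymmetric without swirl), with no decay or boundary bookkeeping at all, as a
corollary of the monotonicity of convex functionals of `Ω` proved in
`AxisymNoSwirlCoSignedFlux` (Gallay–Šverák's Lemma 5.1 route): for `0 ≤ s ≤ t ≤ T`,

* `IsTaoSolutionOn.angVortQuot_le_of_forall_le` — **one-sided maximum principle**: if `0 ≤ M`
  and `Ω(s, ·) ≤ M` then `Ω(t, ·) ≤ M`;
* `IsTaoSolutionOn.le_angVortQuot_of_forall_le` — the mirror: if `m ≤ 0` and `m ≤ Ω(s, ·)` then
  `m ≤ Ω(t, ·)`;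
* `IsTaoSolutionOn.angVortQuot_nonneg_of_forall_nonneg` / `…_nonpos_of_forall_nonpos` — **sign
  persistence**: `ω_θ(s) ≥ 0` everywhere ⟹ `ω_θ(t) ≥ 0` everywhere (the weak form of the strong
  maximum principle quoted above; the class of single-signed axisymmetric swirl-free flows is
  invariant);
* `IsTaoSolutionOn.abs_angVortQuot_le_of_forall_abs_le` — `|Ω(s, ·)| ≤ M ⟹ |Ω(t, ·)| ≤ M`, and
  `IsTaoSolutionOn.eLpNorm_angVortQuot_top_le` — **`‖(ω_θ/r)(t)‖_{L^∞(ℝ³)} ≤ ‖(ω_θ/r)(s)‖_{L^∞(ℝ³)}`**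
  (`eLpNorm · ∞ volume`, no hypothesis; `+∞ ≤ +∞` allowed);
* `IsTaoSolutionOn.norm_curl_le_mul_cylRadius` — the vorticity consequence
  `‖ω(t, x)‖ ≤ M · r(x)` whenever `|Ω(s, ·)| ≤ M` (`ω = (ω_θ/r) · J x`, `‖J x‖ = r`,
  `curl_eq_hadamardQuotFst_smul_rotGen`, `angVortQuot_eq_hadamardQuotFst_curl`): along an
  axisymmetric swirl-free flow vortex stretching raises `|ω|` at most linearly in the distance from
  the axis, with the INITIAL slope `sup|ω_θ/r|`;
* `…_of_datum` forms (`ν > 0`, axisymmetric swirl-free datum `u₀`; symmetry propagates by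
  `IsTaoSolutionOn.isAxisymmetric`, `…hasNoSwirl`).

## The argument (no comparison function, no behaviour at infinity needed)

For `M ≥ 0` let `β_M(w) = ∫₀^{w−M} smoothTransition`. Then `β_M ∈ C²`, `β_M(0) = β_M'(0) = 0`
(as `−M ≤ 0`), `0 ≤ β_M'' ≤ sup|smoothTransition'|`, `β_M ≥ 0`, `β_M(w) = 0` iff `w ≤ M`
(`smoothTransition > 0` on `(0, ∞)`). By `IsTaoSolutionOn.lintegral_comp_angVortQuot_le_of_approx`
(constant sequence `βₙ = β_M`), `∫⁻ β_M(Ω(t)) ≤ ∫⁻ β_M(Ω(s)) = 0`; so the continuous nonnegative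
function `β_M(Ω(t, ·))` vanishes a.e., hence everywhere (`Continuous.ae_eq_iff_eq`, Lebesgue
measure charges open sets), i.e. `Ω(t, ·) ≤ M`. The lower bound uses `w ↦ ∫₀^{m−w} smoothTransition`.
The `L^∞` form: a continuous function is bounded everywhere by its essential supremum
(the open set `{|Ω(s)| > ‖Ω(s)‖_∞}` is null, hence empty).

What is NOT here: the strong maximum principle / strict positivity (Hopf), the strict decrease of
`‖ω_θ‖_{L¹(Ω)}`, Gallay–Šverák's Prop. 2.6 (the Feng–Šverák Biot–Savart bound
`‖u‖_∞ ≤ C‖rω_θ‖_{L¹(Ω)}^{1/2}‖ω_θ/r‖_∞^{1/2}`) and Lemma 6.4 (conservation of the impulse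
`∫ r²ω_θ dr dz` for non-negative solutions), and anything with swirl.

## Mathlib / tree search

Tree: `IsTaoSolutionOn.lintegral_comp_angVortQuot_le_of_approx`, `angVortQuot_eq_hadamardQuotFst_curl`
(`AxisymNoSwirlCoSignedFlux`), `curl_eq_hadamardQuotFst_smul_rotGen` (`AxisymNoSwirlVorticity`),
`norm_rotGen` (`AxisymVorticityAlgebra`), `contDiff_angVortQuot`, `IsTaoSolutionOn.isAxisymmetric`,
`…hasNoSwirl` (`AxisymmetricNoSwirlGlobal`), `Calculus.exists_bound_deriv_smoothTransition`,
`Calculus.differentiable_smoothTransition` (`SmoothCutoff`). `lean search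
'abs_angVortQuot_le|angVortQuot_le_of|angVortQuot_nonneg|eLpNorm_angVortQuot'`: only pointwise-in-`x`
algebraic bounds (`IsAxisymmetric.cylRadius_mul_abs_angVortQuot_le`, `…abs_angVortQuot_le_norm_curl_div`)
— no whole-space-in-time statement before this file; the local cylinder form is
`noSwirl_abs_scalar_le_of_boundary`. Mathlib: `Real.smoothTransition` (`pos_of_pos`,
`zero_of_nonpos`), `intervalIntegral.integral_hasDerivAt_right`,
`intervalIntegral.intervalIntegral_pos_of_pos_on`, `lintegral_eq_zero_iff'`,
`Continuous.ae_eq_iff_eq`, `IsOpen.measure_eq_zero_iff`, `ae_le_eLpNormEssSup`,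
`eLpNormEssSup_le_of_ae_bound`.

## References

* G. Koch, N. Nadirashvili, G. Seregin, V. Šverák, *Liouville theorems for the Navier–Stokes
  equations and applications*, Acta Math. 203 (2009) 83–105 = arXiv:0709.3599, §5 (the equation
  for `ω_θ/r`, arXiv p. 9, before Remark 5.1) and §1 p. 3. [KochNadirashviliSereginSverak2009]
* Th. Gallay, V. Šverák, *Remarks on the Cauchy problem for the axisymmetric Navier–Stokes
  equations*, Confluentes Math. 7 (2015) 67–92 = arXiv:1510.01036, §5, proof of Lemma 5.1
  (arXiv p. 16) and (2.9). [GallaySverak2016]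
* M. R. Ukhovskii, V. I. Yudovich, J. Appl. Math. Mech. 32 (1968) 52–61; O. A. Ladyzhenskaya,
  Zap. Naučn. Sem. LOMI 7 (1968) 155–177 (the equation and maximum principle for `ω_θ/r`).
-/

noncomputable section

open MeasureTheory Set Function Filter Topology
open scoped ENNReal NNReal Topology ContDiff

namespace Literature.Analysis.FluidPDE

/-! ### The barrier functionals `β_M(w) = ∫₀^{w−M} smoothTransition`, `β^m(w) = ∫₀^{m−w} smoothTransition` -/

section Barrier

/-- The primitive `a ↦ ∫₀ᵃ smoothTransition` has derivative `smoothTransition a`. [folklore] -/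
private theorem hasDerivAt_primitive (a : ℝ) :
    HasDerivAt (fun a => ∫ r in (0 : ℝ)..a, Real.smoothTransition r) (Real.smoothTransition a) a := by
  have hc : Continuous Real.smoothTransition := Real.smoothTransition.continuous
  exact intervalIntegral.integral_hasDerivAt_right (hc.intervalIntegrable _ _)
    (hc.stronglyMeasurableAtFilter _ _) hc.continuousAt

/-- `∫₀ᵃ smoothTransition = 0` for `a ≤ 0` (the integrand vanishes on `(-∞, 0]`). [folklore] -/
private theorem primitive_of_nonpos {a : ℝ} (ha : a ≤ 0) :
    (∫ r in (0 : ℝ)..a, Real.smoothTransition r) = 0 := by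
  rw [intervalIntegral.integral_symm]
  have : (∫ r in a..(0 : ℝ), Real.smoothTransition r) = ∫ _ in a..(0 : ℝ), (0 : ℝ) := by
    refine intervalIntegral.integral_congr fun r hr => ?_
    rw [uIcc_of_le ha] at hr
    exact Real.smoothTransition.zero_of_nonpos hr.2
  rw [this, intervalIntegral.integral_zero, neg_zero]

/-- `0 < ∫₀ᵃ smoothTransition` for `0 < a` (the integrand is `> 0` on `(0, ∞)`). [folklore] -/
private theorem primitive_pos {a : ℝ} (ha : 0 < a) :
    0 < ∫ r in (0 : ℝ)..a, Real.smoothTransition r :=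
  intervalIntegral.intervalIntegral_pos_of_pos_on
    (Real.smoothTransition.continuous.intervalIntegrable _ _)
    (fun _ hr => Real.smoothTransition.pos_of_pos hr.1) ha

/-- `0 ≤ ∫₀ᵃ smoothTransition`. [folklore] -/
private theorem primitive_nonneg (a : ℝ) : 0 ≤ ∫ r in (0 : ℝ)..a, Real.smoothTransition r := by
  rcases le_or_gt a 0 with ha | ha
  · rw [primitive_of_nonpos ha]
  · exact (primitive_pos ha).le

/-- `∫₀ᵃ smoothTransition = 0` forces `a ≤ 0`. [folklore] -/
private theorem nonpos_of_primitive_eq_zero {a : ℝ} (h : (∫ r in (0 : ℝ)..a, Real.smoothTransition r) = 0) :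
    a ≤ 0 := by
  by_contra ha
  exact (primitive_pos (lt_of_not_ge ha)).ne' h

/-- `β_M'(w) = smoothTransition (w − M)`. [folklore] -/
private theorem hasDerivAt_upperBarrier (M w : ℝ) :
    HasDerivAt (fun w => ∫ r in (0 : ℝ)..(w - M), Real.smoothTransition r)
      (Real.smoothTransition (w - M)) w := by
  have h2 : HasDerivAt (fun w => w - M) 1 w := (hasDerivAt_id w).sub_const M
  have h := (hasDerivAt_primitive (w - M)).comp w h2
  rw [mul_one] at h
  exact h

/-- `deriv β_M = smoothTransition (· − M)`. [folklore] -/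
private theorem deriv_upperBarrier (M : ℝ) :
    deriv (fun w => ∫ r in (0 : ℝ)..(w - M), Real.smoothTransition r) =
      fun w => Real.smoothTransition (w - M) :=
  funext fun w => (hasDerivAt_upperBarrier M w).deriv

/-- `β_M ∈ C²`. [folklore] -/
private theorem contDiff_upperBarrier (M : ℝ) :
    ContDiff ℝ 2 fun w => ∫ r in (0 : ℝ)..(w - M), Real.smoothTransition r := by
  rw [show (2 : WithTop ℕ∞) = 1 + 1 by norm_num, contDiff_succ_iff_deriv]
  refine ⟨fun w => (hasDerivAt_upperBarrier M w).differentiableAt, fun h => absurd h (by simp), ?_⟩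
  rw [deriv_upperBarrier]
  have h : ContDiff ℝ ((1 : ℕ∞) : WithTop ℕ∞) fun w : ℝ => Real.smoothTransition (w - M) :=
    (Real.smoothTransition.contDiff (n := 1)).comp (contDiff_id.sub contDiff_const)
  exact_mod_cast h

/-- `β_M''(w) = smoothTransition' (w − M)`. [folklore] -/
private theorem deriv_deriv_upperBarrier (M w : ℝ) :
    deriv (deriv fun w => ∫ r in (0 : ℝ)..(w - M), Real.smoothTransition r) w =
      deriv Real.smoothTransition (w - M) := by
  rw [deriv_upperBarrier]
  have h1 : HasDerivAt Real.smoothTransition (deriv Real.smoothTransition (w - M)) (w - M) :=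
    (Calculus.differentiable_smoothTransition (w - M)).hasDerivAt
  have h2 := h1.comp w ((hasDerivAt_id w).sub_const M)
  have h : HasDerivAt (fun w => Real.smoothTransition (w - M))
      (deriv Real.smoothTransition (w - M) * 1) w := h2
  rw [h.deriv, mul_one]

/-- `(β^m)'(w) = −smoothTransition (m − w)`. [folklore] -/
private theorem hasDerivAt_lowerBarrier (m w : ℝ) :
    HasDerivAt (fun w => ∫ r in (0 : ℝ)..(m - w), Real.smoothTransition r)
      (-Real.smoothTransition (m - w)) w := by
  have h2 : HasDerivAt (fun w => m - w) (-1) w := (hasDerivAt_id w).const_sub m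
  have h := (hasDerivAt_primitive (m - w)).comp w h2
  have e : Real.smoothTransition (m - w) * -1 = -Real.smoothTransition (m - w) := by ring
  rw [e] at h
  exact h

/-- `deriv β^m = −smoothTransition (m − ·)`. [folklore] -/
private theorem deriv_lowerBarrier (m : ℝ) :
    deriv (fun w => ∫ r in (0 : ℝ)..(m - w), Real.smoothTransition r) =
      fun w => -Real.smoothTransition (m - w) :=
  funext fun w => (hasDerivAt_lowerBarrier m w).deriv

/-- `β^m ∈ C²`. [folklore] -/
private theorem contDiff_lowerBarrier (m : ℝ) :
    ContDiff ℝ 2 fun w => ∫ r in (0 : ℝ)..(m - w), Real.smoothTransition r := by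
  rw [show (2 : WithTop ℕ∞) = 1 + 1 by norm_num, contDiff_succ_iff_deriv]
  refine ⟨fun w => (hasDerivAt_lowerBarrier m w).differentiableAt, fun h => absurd h (by simp), ?_⟩
  rw [deriv_lowerBarrier]
  have h : ContDiff ℝ ((1 : ℕ∞) : WithTop ℕ∞) fun w : ℝ => -Real.smoothTransition (m - w) :=
    ((Real.smoothTransition.contDiff (n := 1)).comp (contDiff_const.sub contDiff_id)).neg
  exact_mod_cast h

/-- `(β^m)''(w) = smoothTransition' (m − w)`. [folklore] -/
private theorem deriv_deriv_lowerBarrier (m w : ℝ) :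
    deriv (deriv fun w => ∫ r in (0 : ℝ)..(m - w), Real.smoothTransition r) w =
      deriv Real.smoothTransition (m - w) := by
  rw [deriv_lowerBarrier]
  have h1 : HasDerivAt Real.smoothTransition (deriv Real.smoothTransition (m - w)) (m - w) :=
    (Calculus.differentiable_smoothTransition (m - w)).hasDerivAt
  have h2 := (h1.comp w ((hasDerivAt_id w).const_sub m)).neg
  have h : HasDerivAt (fun w => -Real.smoothTransition (m - w))
      (-(deriv Real.smoothTransition (m - w) * -1)) w := h2
  rw [h.deriv]
  ring

end Barrier

/-! ### The maximum principle for `Ω = ω_θ/r` along a Tao-class solution -/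

section MaxPrinciple

variable {T ν : ℝ} {u₀ : EuclideanSpace ℝ (Fin 3) → EuclideanSpace ℝ (Fin 3)}
  {v : ℝ → EuclideanSpace ℝ (Fin 3) → EuclideanSpace ℝ (Fin 3)} {q : ℝ → EuclideanSpace ℝ (Fin 3) → ℝ}

/-- `Ω(t) = ω_θ/r` is continuous at every time of the slab. [folklore] -/
private theorem IsTaoSolutionOn.continuous_angVortQuot (h : IsTaoSolutionOn T ν u₀ v q) {t : ℝ}
    (ht : t ∈ Icc 0 T) : Continuous (angVortQuot (v t)) :=
  (contDiff_angVortQuot (n := 0)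
    (by exact_mod_cast (h.classical.contDiff_velocity ht).of_le (by norm_cast))).continuous

/-- **Core step.** If `β` is admissible (`C²`, `β(0) = β'(0) = 0`, `0 ≤ β'' ≤ K`) and
nonnegative, and `β(Ω(s, ·)) ≡ 0`, then `β(Ω(t, ·)) ≡ 0` for `s ≤ t` in `[0, T]`: by
`…lintegral_comp_angVortQuot_le_of_approx`, `∫⁻ β(Ω(t)) ≤ ∫⁻ β(Ω(s)) = 0`, and a continuous
nonnegative function with zero integral vanishes (Lebesgue measure charges open sets). [folklore] -/
private theorem IsTaoSolutionOn.comp_angVortQuot_eq_zero (h : IsTaoSolutionOn T ν u₀ v q)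
    (hT : 0 < T) (hν : 0 ≤ ν) (hax : ∀ t ∈ Icc 0 T, IsAxisymmetric (v t))
    (hsw : ∀ t ∈ Icc 0 T, HasNoSwirl (v t)) {β : ℝ → ℝ} {K : ℝ}
    (hβ : ContDiff ℝ 2 β) (h00 : β 0 = 0) (h0 : deriv β 0 = 0)
    (hnn : ∀ w, 0 ≤ deriv (deriv β) w) (hK : ∀ w, deriv (deriv β) w ≤ K) (hβnn : ∀ w, 0 ≤ β w)
    {s t : ℝ} (hs : s ∈ Icc 0 T) (ht : t ∈ Icc 0 T) (hst : s ≤ t)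
    (hzero : ∀ x, β (angVortQuot (v s) x) = 0) (x : EuclideanSpace ℝ (Fin 3)) :
    β (angVortQuot (v t) x) = 0 := by
  have hle := h.lintegral_comp_angVortQuot_le_of_approx hT hν hax hsw (ψ := β) (βs := fun _ => β)
    (Ks := fun _ => K) (fun _ => hβ) (fun _ => h00) (fun _ => h0) (fun _ => hnn) (fun _ => hK)
    (fun _ _ => le_rfl) (fun _ => tendsto_const_nhds) hs ht hst
  have hR : ∫⁻ x, ENNReal.ofReal (β (angVortQuot (v s) x)) = 0 := by
    simp [hzero]
  rw [hR] at hle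
  replace hle := le_zero_iff.1 hle
  have hcont : Continuous fun x => β (angVortQuot (v t) x) :=
    hβ.continuous.comp (h.continuous_angVortQuot ht)
  have hae : (fun x => ENNReal.ofReal (β (angVortQuot (v t) x))) =ᵐ[volume] 0 :=
    (lintegral_eq_zero_iff' hcont.measurable.ennreal_ofReal.aemeasurable).1 hle
  have hae' : (fun x => β (angVortQuot (v t) x)) =ᵐ[volume] fun _ => (0 : ℝ) := by
    filter_upwards [hae] with x hx
    exact le_antisymm (ENNReal.ofReal_eq_zero.1 hx) (hβnn _)
  have heq := (Continuous.ae_eq_iff_eq volume hcont continuous_const).1 hae'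
  exact congrFun heq x

/-- **One-sided maximum principle for `ω_θ/r`, whole space.** Let `(v, q)` be a Tao-class
solution of the unforced Navier–Stokes system on `[0, T] × ℝ³` (`IsTaoSolutionOn T ν u₀ v q`,
`0 < T`, `ν ≥ 0`) whose slices are axisymmetric without swirl, `Ω = angVortQuot (v ·) = ω_θ/r`.
If `0 ≤ M` and `Ω(s, x) ≤ M` for all `x`, then `Ω(t, x) ≤ M` for all `x`, `0 ≤ s ≤ t ≤ T`
(the equation `Ω_t + u·∇Ω = ν(Δ + (2/r)∂ᵣ)Ω` has no zeroth-order term).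
[cite: KochNadirashviliSereginSverak2009, §5 (equation for ω_θ/r before Remark 5.1, arXiv p. 9) and §1 p. 3] -/
theorem IsTaoSolutionOn.angVortQuot_le_of_forall_le (h : IsTaoSolutionOn T ν u₀ v q)
    (hT : 0 < T) (hν : 0 ≤ ν) (hax : ∀ t ∈ Icc 0 T, IsAxisymmetric (v t))
    (hsw : ∀ t ∈ Icc 0 T, HasNoSwirl (v t)) {M : ℝ} (hM : 0 ≤ M)
    {s t : ℝ} (hs : s ∈ Icc 0 T) (ht : t ∈ Icc 0 T) (hst : s ≤ t)
    (hle : ∀ x, angVortQuot (v s) x ≤ M) (x : EuclideanSpace ℝ (Fin 3)) :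
    angVortQuot (v t) x ≤ M := by
  obtain ⟨D, -, hD⟩ := Calculus.exists_bound_deriv_smoothTransition
  have hz := h.comp_angVortQuot_eq_zero hT hν hax hsw
    (β := fun w => ∫ r in (0 : ℝ)..(w - M), Real.smoothTransition r) (K := D)
    (contDiff_upperBarrier M) (primitive_of_nonpos (by linarith)) ?_ (fun w => ?_) (fun w => ?_)
    (fun w => primitive_nonneg _) hs ht hst (fun y => primitive_of_nonpos (by linarith [hle y])) x
  · exact sub_nonpos.1 (nonpos_of_primitive_eq_zero hz)
  · rw [deriv_upperBarrier]
    exact Real.smoothTransition.zero_of_nonpos (by linarith)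
  · rw [deriv_deriv_upperBarrier]
    exact Real.smoothTransition.monotone.deriv_nonneg
  · rw [deriv_deriv_upperBarrier]
    exact (le_abs_self _).trans (hD _)

/-- **The mirror statement**: if `m ≤ 0` and `m ≤ Ω(s, x)` for all `x`, then `m ≤ Ω(t, x)` for
all `x`, `0 ≤ s ≤ t ≤ T` (barrier `w ↦ ∫₀^{m−w} smoothTransition`).
[cite: KochNadirashviliSereginSverak2009, §5 (equation for ω_θ/r before Remark 5.1, arXiv p. 9) and §1 p. 3] -/
theorem IsTaoSolutionOn.le_angVortQuot_of_forall_le (h : IsTaoSolutionOn T ν u₀ v q)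
    (hT : 0 < T) (hν : 0 ≤ ν) (hax : ∀ t ∈ Icc 0 T, IsAxisymmetric (v t))
    (hsw : ∀ t ∈ Icc 0 T, HasNoSwirl (v t)) {m : ℝ} (hm : m ≤ 0)
    {s t : ℝ} (hs : s ∈ Icc 0 T) (ht : t ∈ Icc 0 T) (hst : s ≤ t)
    (hle : ∀ x, m ≤ angVortQuot (v s) x) (x : EuclideanSpace ℝ (Fin 3)) :
    m ≤ angVortQuot (v t) x := by
  obtain ⟨D, -, hD⟩ := Calculus.exists_bound_deriv_smoothTransition
  have hz := h.comp_angVortQuot_eq_zero hT hν hax hsw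
    (β := fun w => ∫ r in (0 : ℝ)..(m - w), Real.smoothTransition r) (K := D)
    (contDiff_lowerBarrier m) (primitive_of_nonpos (by linarith)) ?_ (fun w => ?_) (fun w => ?_)
    (fun w => primitive_nonneg _) hs ht hst (fun y => primitive_of_nonpos (by linarith [hle y])) x
  · exact sub_nonpos.1 (nonpos_of_primitive_eq_zero hz)
  · rw [deriv_lowerBarrier]
    simp only [sub_zero, neg_eq_zero]
    exact Real.smoothTransition.zero_of_nonpos hm
  · rw [deriv_deriv_lowerBarrier]
    exact Real.smoothTransition.monotone.deriv_nonneg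
  · rw [deriv_deriv_lowerBarrier]
    exact (le_abs_self _).trans (hD _)

/-- **Sign persistence** (`ω_θ ≥ 0` is preserved): if `Ω(s, ·) ≥ 0` then `Ω(t, ·) ≥ 0` for
`0 ≤ s ≤ t ≤ T` — the class of single-signed axisymmetric swirl-free flows is invariant
(the weak form of "by the strong maximum principle, the solution `ω_θ(t)` … is strictly
positive"). [cite: GallaySverak2016, §5 proof of Lemma 5.1 (arXiv p. 16)] -/
theorem IsTaoSolutionOn.angVortQuot_nonneg_of_forall_nonneg (h : IsTaoSolutionOn T ν u₀ v q)
    (hT : 0 < T) (hν : 0 ≤ ν) (hax : ∀ t ∈ Icc 0 T, IsAxisymmetric (v t))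
    (hsw : ∀ t ∈ Icc 0 T, HasNoSwirl (v t))
    {s t : ℝ} (hs : s ∈ Icc 0 T) (ht : t ∈ Icc 0 T) (hst : s ≤ t)
    (hle : ∀ x, 0 ≤ angVortQuot (v s) x) (x : EuclideanSpace ℝ (Fin 3)) :
    0 ≤ angVortQuot (v t) x :=
  h.le_angVortQuot_of_forall_le hT hν hax hsw le_rfl hs ht hst hle x

/-- **Sign persistence, mirror**: if `Ω(s, ·) ≤ 0` then `Ω(t, ·) ≤ 0` for `0 ≤ s ≤ t ≤ T`.
[cite: GallaySverak2016, §5 proof of Lemma 5.1 (arXiv p. 16)] -/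
theorem IsTaoSolutionOn.angVortQuot_nonpos_of_forall_nonpos (h : IsTaoSolutionOn T ν u₀ v q)
    (hT : 0 < T) (hν : 0 ≤ ν) (hax : ∀ t ∈ Icc 0 T, IsAxisymmetric (v t))
    (hsw : ∀ t ∈ Icc 0 T, HasNoSwirl (v t))
    {s t : ℝ} (hs : s ∈ Icc 0 T) (ht : t ∈ Icc 0 T) (hst : s ≤ t)
    (hle : ∀ x, angVortQuot (v s) x ≤ 0) (x : EuclideanSpace ℝ (Fin 3)) :
    angVortQuot (v t) x ≤ 0 :=
  h.angVortQuot_le_of_forall_le hT hν hax hsw le_rfl hs ht hst hle x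

/-- **Two-sided maximum principle**: `|Ω(s, ·)| ≤ M` implies `|Ω(t, ·)| ≤ M` for
`0 ≤ s ≤ t ≤ T` — `sup|ω_θ/r|` is non-increasing along an axisymmetric swirl-free flow.
[cite: KochNadirashviliSereginSverak2009, §5 (equation for ω_θ/r before Remark 5.1, arXiv p. 9) and §1 p. 3] -/
theorem IsTaoSolutionOn.abs_angVortQuot_le_of_forall_abs_le (h : IsTaoSolutionOn T ν u₀ v q)
    (hT : 0 < T) (hν : 0 ≤ ν) (hax : ∀ t ∈ Icc 0 T, IsAxisymmetric (v t))
    (hsw : ∀ t ∈ Icc 0 T, HasNoSwirl (v t)) {M : ℝ}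
    {s t : ℝ} (hs : s ∈ Icc 0 T) (ht : t ∈ Icc 0 T) (hst : s ≤ t)
    (hle : ∀ x, |angVortQuot (v s) x| ≤ M) (x : EuclideanSpace ℝ (Fin 3)) :
    |angVortQuot (v t) x| ≤ M := by
  have hM : 0 ≤ M := (abs_nonneg _).trans (hle 0)
  rw [abs_le]
  exact ⟨h.le_angVortQuot_of_forall_le hT hν hax hsw (neg_nonpos.2 hM) hs ht hst
      (fun y => (abs_le.1 (hle y)).1) x,
    h.angVortQuot_le_of_forall_le hT hν hax hsw hM hs ht hst (fun y => (abs_le.1 (hle y)).2) x⟩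

/-- A continuous real function is bounded everywhere by its `L^∞` norm (Lebesgue measure charges
open sets). [folklore] -/
private theorem abs_le_toReal_eLpNorm_top_of_continuous {g : EuclideanSpace ℝ (Fin 3) → ℝ}
    (hg : Continuous g) (hfin : eLpNorm g ∞ volume ≠ ⊤) (x : EuclideanSpace ℝ (Fin 3)) :
    |g x| ≤ (eLpNorm g ∞ volume).toReal := by
  set C := eLpNorm g ∞ volume with hC
  have hae : ∀ᵐ y ∂(volume : Measure (EuclideanSpace ℝ (Fin 3))), ‖g y‖ₑ ≤ C := by
    rw [hC, eLpNorm_exponent_top]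
    exact ae_le_eLpNormEssSup
  -- the open set `{C.toReal < |g|}` is null, hence empty
  have hU : IsOpen {y | C.toReal < |g y|} := isOpen_lt continuous_const (continuous_abs.comp hg)
  have hnull : volume {y | C.toReal < |g y|} = 0 := by
    have h2 : ∀ᵐ y ∂(volume : Measure (EuclideanSpace ℝ (Fin 3))), ¬ (C.toReal < |g y|) := by
      filter_upwards [hae] with y hy
      rw [Real.enorm_eq_ofReal_abs] at hy
      exact not_lt.2 ((ENNReal.ofReal_le_iff_le_toReal hfin).1 hy)
    rw [ae_iff] at h2
    simpa only [not_not] using h2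
  have hempty := (hU.measure_eq_zero_iff volume).1 hnull
  have hx : x ∉ {y | C.toReal < |g y|} := by rw [hempty]; exact notMem_empty x
  exact not_lt.1 hx

/-- **The maximum principle for `ω_θ/r` in `L^∞(ℝ³)`** (Ukhovskii–Yudovich / Ladyzhenskaya 1968;
KNSS 2009, §5): for a Tao-class solution of the unforced Navier–Stokes system on `[0, T] × ℝ³`
(`0 < T`, `ν ≥ 0`) with axisymmetric swirl-free slices and `0 ≤ s ≤ t ≤ T`,
`‖(ω_θ/r)(t)‖_{L^∞(ℝ³)} ≤ ‖(ω_θ/r)(s)‖_{L^∞(ℝ³)}` (`eLpNorm (angVortQuot (v ·)) ∞ volume`; no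
finiteness hypothesis). [cite: KochNadirashviliSereginSverak2009, §5 (equation for ω_θ/r before Remark 5.1, arXiv p. 9) and §1 p. 3] -/
theorem IsTaoSolutionOn.eLpNorm_angVortQuot_top_le (h : IsTaoSolutionOn T ν u₀ v q)
    (hT : 0 < T) (hν : 0 ≤ ν) (hax : ∀ t ∈ Icc 0 T, IsAxisymmetric (v t))
    (hsw : ∀ t ∈ Icc 0 T, HasNoSwirl (v t))
    {s t : ℝ} (hs : s ∈ Icc 0 T) (ht : t ∈ Icc 0 T) (hst : s ≤ t) :
    eLpNorm (angVortQuot (v t)) ∞ volume ≤ eLpNorm (angVortQuot (v s)) ∞ volume := by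
  by_cases hfin : eLpNorm (angVortQuot (v s)) ∞ volume = ⊤
  · rw [hfin]; exact le_top
  set C := eLpNorm (angVortQuot (v s)) ∞ volume with hC
  have hs' : ∀ x, |angVortQuot (v s) x| ≤ C.toReal :=
    abs_le_toReal_eLpNorm_top_of_continuous (h.continuous_angVortQuot hs) hfin
  have ht' : ∀ x, |angVortQuot (v t) x| ≤ C.toReal :=
    h.abs_angVortQuot_le_of_forall_abs_le hT hν hax hsw hs ht hst hs'
  calc eLpNorm (angVortQuot (v t)) ∞ volume
      ≤ ENNReal.ofReal C.toReal := by
        rw [eLpNorm_exponent_top]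
        exact eLpNormEssSup_le_of_ae_bound (ae_of_all _ fun x => by
          rw [Real.norm_eq_abs]; exact ht' x)
    _ = C := ENNReal.ofReal_toReal hfin

/-- **Vorticity consequence**: if `|Ω(s, ·)| ≤ M` then `‖ω(t, x)‖ ≤ M · r(x)` for all `x` and
`0 ≤ s ≤ t ≤ T` (`ω = curl v = (ω_θ/r) · J x` for axisymmetric swirl-free fields, `‖J x‖ = r`):
stretching raises `|ω|` at most linearly in the distance from the axis, with the initial slope.
[cite: KochNadirashviliSereginSverak2009, §5 pp. 9–10 and Remark 5.1] -/
theorem IsTaoSolutionOn.norm_curl_le_mul_cylRadius (h : IsTaoSolutionOn T ν u₀ v q)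
    (hT : 0 < T) (hν : 0 ≤ ν) (hax : ∀ t ∈ Icc 0 T, IsAxisymmetric (v t))
    (hsw : ∀ t ∈ Icc 0 T, HasNoSwirl (v t)) {M : ℝ}
    {s t : ℝ} (hs : s ∈ Icc 0 T) (ht : t ∈ Icc 0 T) (hst : s ≤ t)
    (hle : ∀ x, |angVortQuot (v s) x| ≤ M) (x : EuclideanSpace ℝ (Fin 3)) :
    ‖curl (v t) x‖ ≤ M * cylRadius x := by
  have hb := h.abs_angVortQuot_le_of_forall_abs_le hT hν hax hsw hs ht hst hle x
  have hv3 : ContDiff ℝ 3 (v t) := (h.classical.contDiff_velocity ht).of_le (by norm_cast)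
  have hv2 : ContDiff ℝ 2 (v t) := hv3.of_le (by norm_cast)
  rw [curl_eq_hadamardQuotFst_smul_rotGen (hax t ht) (hsw t ht) hv2 x,
    ← angVortQuot_eq_hadamardQuotFst_curl (hax t ht) (hsw t ht) hv3, norm_smul, Real.norm_eq_abs,
    norm_rotGen]
  exact mul_le_mul_of_nonneg_right hb (Real.sqrt_nonneg _)

end MaxPrinciple

/-! ### Statements from an axisymmetric swirl-free DATUM (`ν > 0`) -/

section Data

variable {T ν : ℝ} {u₀ : EuclideanSpace ℝ (Fin 3) → EuclideanSpace ℝ (Fin 3)}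
  {v : ℝ → EuclideanSpace ℝ (Fin 3) → EuclideanSpace ℝ (Fin 3)} {q : ℝ → EuclideanSpace ℝ (Fin 3) → ℝ}

/-- **Maximum principle for `ω_θ/r` from the datum**: for a Tao-class solution `(v, q)` on
`[0, T]` (`0 < T`) of the unforced Navier–Stokes system with `ν > 0` whose datum `u₀` is
axisymmetric without swirl (the solution stays so: `IsTaoSolutionOn.isAxisymmetric`,
`…hasNoSwirl`) and `0 ≤ s ≤ t ≤ T`: `‖(ω_θ/r)(t)‖_{L^∞(ℝ³)} ≤ ‖(ω_θ/r)(s)‖_{L^∞(ℝ³)}`.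
[cite: KochNadirashviliSereginSverak2009, §5 (equation for ω_θ/r before Remark 5.1, arXiv p. 9) and §1 p. 3] -/
theorem IsTaoSolutionOn.eLpNorm_angVortQuot_top_le_of_datum (h : IsTaoSolutionOn T ν u₀ v q)
    (hT : 0 < T) (hν : 0 < ν) (h0 : IsAxisymmetric u₀) (h0' : HasNoSwirl u₀)
    {s t : ℝ} (hs : s ∈ Icc 0 T) (ht : t ∈ Icc 0 T) (hst : s ≤ t) :
    eLpNorm (angVortQuot (v t)) ∞ volume ≤ eLpNorm (angVortQuot (v s)) ∞ volume :=
  h.eLpNorm_angVortQuot_top_le hT hν.le (h.isAxisymmetric hν hT h0) (h.hasNoSwirl hν hT h0 h0')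
    hs ht hst

/-- **From the datum, pointwise form**: `|Ω(0, ·)| = |angVortQuot u₀| ≤ M` implies
`|Ω(t, ·)| ≤ M` on `[0, T]`. [cite: KochNadirashviliSereginSverak2009, §5 (equation for ω_θ/r before Remark 5.1, arXiv p. 9) and §1 p. 3] -/
theorem IsTaoSolutionOn.abs_angVortQuot_le_of_datum (h : IsTaoSolutionOn T ν u₀ v q)
    (hT : 0 < T) (hν : 0 < ν) (h0 : IsAxisymmetric u₀) (h0' : HasNoSwirl u₀) {M : ℝ}
    (hle : ∀ x, |angVortQuot u₀ x| ≤ M) {t : ℝ} (ht : t ∈ Icc 0 T) (x : EuclideanSpace ℝ (Fin 3)) :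
    |angVortQuot (v t) x| ≤ M := by
  have h0T : (0 : ℝ) ∈ Icc 0 T := ⟨le_rfl, hT.le⟩
  refine h.abs_angVortQuot_le_of_forall_abs_le hT hν.le (h.isAxisymmetric hν hT h0)
    (h.hasNoSwirl hν hT h0 h0') h0T ht ht.1 (fun y => ?_) x
  rw [h.initial]
  exact hle y

/-- **From the datum, sign persistence**: `ω_θ(0) ≥ 0` (i.e. `angVortQuot u₀ ≥ 0`) implies
`Ω(t, ·) ≥ 0` on `[0, T]`. [cite: GallaySverak2016, §5 proof of Lemma 5.1 (arXiv p. 16)] -/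
theorem IsTaoSolutionOn.angVortQuot_nonneg_of_datum (h : IsTaoSolutionOn T ν u₀ v q)
    (hT : 0 < T) (hν : 0 < ν) (h0 : IsAxisymmetric u₀) (h0' : HasNoSwirl u₀)
    (hle : ∀ x, 0 ≤ angVortQuot u₀ x) {t : ℝ} (ht : t ∈ Icc 0 T) (x : EuclideanSpace ℝ (Fin 3)) :
    0 ≤ angVortQuot (v t) x := by
  have h0T : (0 : ℝ) ∈ Icc 0 T := ⟨le_rfl, hT.le⟩
  refine h.angVortQuot_nonneg_of_forall_nonneg hT hν.le (h.isAxisymmetric hν hT h0)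
    (h.hasNoSwirl hν hT h0 h0') h0T ht ht.1 (fun y => ?_) x
  rw [h.initial]
  exact hle y

/-- **From the datum, vorticity form**: `|angVortQuot u₀| ≤ M` implies `‖ω(t, x)‖ ≤ M · r(x)` on
`[0, T] × ℝ³`. [cite: KochNadirashviliSereginSverak2009, §5 pp. 9–10 and Remark 5.1] -/
theorem IsTaoSolutionOn.norm_curl_le_mul_cylRadius_of_datum (h : IsTaoSolutionOn T ν u₀ v q)
    (hT : 0 < T) (hν : 0 < ν) (h0 : IsAxisymmetric u₀) (h0' : HasNoSwirl u₀) {M : ℝ}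
    (hle : ∀ x, |angVortQuot u₀ x| ≤ M) {t : ℝ} (ht : t ∈ Icc 0 T) (x : EuclideanSpace ℝ (Fin 3)) :
    ‖curl (v t) x‖ ≤ M * cylRadius x := by
  have h0T : (0 : ℝ) ∈ Icc 0 T := ⟨le_rfl, hT.le⟩
  refine h.norm_curl_le_mul_cylRadius hT hν.le (h.isAxisymmetric hν hT h0)
    (h.hasNoSwirl hν hT h0 h0') h0T ht ht.1 (fun y => ?_) x
  rw [h.initial]
  exact hle y

end Data

end Literature.Analysis.FluidPDE

end
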